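import Summits.ValiantsHypothesis.ValiantsHypothesis.Theorems.DepthWindowHomFlatRank
import Literature.Computability.Complexity.ConstantDepthIMMProofs
import HarnessLib

/-!
# Route `DepthWindow` — the LST bound for HOMOGENEOUS circuits with explicit constants (exponent `d^{1/(2^Δ-1)}`)

Helper file of the route `Theses/DepthWindow.lean` (decomp-valiant workshop, lens 4, generation 9; port plan `PLAN-w2`
R1, second file).  `DepthWindowHomFlatRank.lean` proved the flat two-case rank induction for circuits with rigid
constant terms; this file runs the word-polynomial programme of [LimayeSrinivasanTavenas2025, Cor. 4] on it, exactly
as `DepthWindowLSTExplicit.lst_explicit` does for the tree's general-circuit engine: the greedy `k`-unbiased word with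
`k = ⌊log₂ n⌋`, the block-preserving word substitution `wordSubst` (`aeval_wordSubst_immPoly`: `P_w` is a projection
of `IMM_{n,d}` by block variables and `0`, so homogeneity of the gate values survives — `rigid_of_gateValues`), the
lower bound `relRank_wordPoly_ge : 2^{-k/2} ≤ relrk_w(P_w)` and the upper bound `relRank_eval_le_geom`.

* `homLst_geom` : for a circuit `C` of product-depth `≤ Δ` all of whose gate values are homogeneous, computing
  `IMM_{n,d}` over any field, `1 ≤ λ`, `λ^{2^Δ-1} 2^{2^Δ} ≤ d`, `10 d ≤ ⌊log₂ n⌋ =: k`: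
  `2^{-k/2} ≤ (s d^d + 1)^Δ · 2^{-k λ/20}` (`s = C.size`);
* `homLst_geom_solved` : the same solved for the size, `2^{k (λ - 10)/(20 Δ)} ≤ s d^d + 1` (`Δ ≥ 1`).

With `λ = (d/2^{2^Δ})^{1/(2^Δ-1)} ≥ d^{1/(2^Δ-1)}/4` this is `s ≥ n^{Ω(d^{1/(2^Δ-1)}/Δ)} / d^d`, the LST 2021 exponent for
set-multilinear / homogeneous low-depth circuits in the low-degree regime; what remains for the kernel column
«Hard(σ), σ < 1» of the dial (`HomImmHardAt p q` for `p < q`) is pure arithmetic in `m` (`n = m`, `d = ⌊√⌊log₂ m⌋⌋`,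
`Δ = ⌊p ⌊log₂⌊log₂⌊log₂ m⌋⌋⌋/q⌋ + c`: `λ/Δ → ∞`).  Unconditional, 0 sorry, def-free; rung currency only — nothing here
bears on `VP ≠ VNP` itself.

References: [LimayeSrinivasanTavenas2025] Cor. 4, Lemma 8, Lemma 15, Claim 16; [BhargavDuttaSaxena2024] Thm 1.4, Lemma 7.
-/

-- layout Summits/ValiantsHypothesis/ValiantsHypothesis forces the duplicated namespace component
set_option linter.dupNamespace false

namespace Summit.ValiantsHypothesis.ValiantsHypothesis.Theorems.DepthWindow

open MvPolynomial Real Literature.Computability.AlgebraicComplexity ArithCircuit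
open Literature.Computability.AlgebraicComplexity.LSTWord
open Literature.Computability.Complexity

noncomputable section

universe u

/-- **LST for homogeneous circuits, explicit geometric form**: over any field, a circuit of product-depth `≤ Δ` all
of whose gate values are homogeneous, computing `IMM_{n,d}`, with `1 ≤ λ`, `λ^{2^Δ-1} 2^{2^Δ} ≤ d` and
`10 d ≤ ⌊log₂ n⌋ = k`, satisfies `2^{-k/2} ≤ (s d^d + 1)^Δ 2^{-kλ/20}`.
[cite: LimayeSrinivasanTavenas2025, Cor. 4] -/
theorem homLst_geom (K : Type u) [Field K] {Δ : ℕ} (n d : ℕ) (hd1 : 1 ≤ d) {lam : ℝ} (hlam : 1 ≤ lam)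
    (hfit : lam ^ (2 ^ Δ - 1) * 2 ^ (2 ^ Δ) ≤ (d : ℝ)) (hdn : 10 * d ≤ Nat.log 2 n)
    (C : ArithCircuit K (Fin d × Fin n × Fin n)) (hCΔ : C.productDepth ≤ Δ)
    (hhom : ∀ v ∈ ArithCircuit.gateValues C.gates, ∃ e : ℕ, v.IsHomogeneous e)
    (hC : C.Computes (immPoly n d K)) :
    (2 : ℝ) ^ (-(Nat.log 2 n : ℝ) / 2) ≤
      ((C.size * d ^ d + 1 : ℕ) : ℝ) ^ Δ * (2 : ℝ) ^ (-(Nat.log 2 n : ℝ) * lam / 20) := by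
  set k := Nat.log 2 n with hk
  have hk1 : 1 ≤ k := le_trans (by omega) hdn
  have hn0 : n ≠ 0 := by
    rintro rfl
    rw [Nat.log_zero_right] at hk
    omega
  have h2k : 2 ^ k ≤ n := Nat.pow_log_le_self 2 hn0
  -- the greedy `k`-unbiased word and the word substitution
  set pos := greedyWord d k with hpos
  have hover : ∀ t, t ≤ d → overLen k pos t ≤ k := by
    intro t ht
    rw [overLen_eq_natAbs k pos t ht]
    have h := abs_prefixSum_greedyWord_le d k t ht
    rw [← hpos, abs_le] at h
    omega
  have hn' : ∀ t, t ≤ d → 2 ^ overLen k pos t ≤ n := fun t ht =>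
    (Nat.pow_le_pow_right Nat.two_pos (hover t ht)).trans h2k
  have hg := isBlockPreserving_wordSubst k pos K hn'
  have heval : aeval (wordSubst k pos K hn') C.eval = wordPoly k pos K := by
    rw [show C.eval = immPoly n d K from hC]
    exact aeval_wordSubst_immPoly k pos K hn' hd1
  have hrig := rigid_of_gateValues (k := k) (pos := pos) hg hhom Δ
  have hup := relRank_eval_le_geom (P := C) hg hlam hdn hd1 hCΔ hfit hrig
  rw [heval] at hup
  exact (relRank_wordPoly_ge k pos K (hover d le_rfl)).trans hup

/-- **Solved for the size**: under the hypotheses of `homLst_geom` and `Δ ≥ 1`,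
`2^{k (λ - 10)/(20 Δ)} ≤ s d^d + 1` (`k = ⌊log₂ n⌋`). [cite: LimayeSrinivasanTavenas2025, Cor. 4] -/
theorem homLst_geom_solved (K : Type u) [Field K] {Δ : ℕ} (hΔ : 1 ≤ Δ) (n d : ℕ) (hd1 : 1 ≤ d) {lam : ℝ}
    (hlam : 1 ≤ lam) (hfit : lam ^ (2 ^ Δ - 1) * 2 ^ (2 ^ Δ) ≤ (d : ℝ)) (hdn : 10 * d ≤ Nat.log 2 n)
    (C : ArithCircuit K (Fin d × Fin n × Fin n)) (hCΔ : C.productDepth ≤ Δ)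
    (hhom : ∀ v ∈ ArithCircuit.gateValues C.gates, ∃ e : ℕ, v.IsHomogeneous e)
    (hC : C.Computes (immPoly n d K)) :
    (2 : ℝ) ^ ((Nat.log 2 n : ℝ) * (lam - 10) / (20 * Δ)) ≤ ((C.size * d ^ d + 1 : ℕ) : ℝ) := by
  have h := homLst_geom K n d hd1 hlam hfit hdn C hCΔ hhom hC
  set k := Nat.log 2 n
  set X : ℝ := ((C.size * d ^ d + 1 : ℕ) : ℝ) with hX
  have hX0 : 0 ≤ X := Nat.cast_nonneg _
  have h2 : (0 : ℝ) < 2 := by norm_num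
  -- multiply by `2^{kλ/20}`
  have h1 : (2 : ℝ) ^ ((k : ℝ) * (lam - 10) / 20) ≤ X ^ Δ := by
    have hmul := mul_le_mul_of_nonneg_right h (Real.rpow_nonneg h2.le ((k : ℝ) * lam / 20))
    rw [mul_assoc, ← Real.rpow_add h2, ← Real.rpow_add h2] at hmul
    have e1 : -(k : ℝ) / 2 + (k : ℝ) * lam / 20 = (k : ℝ) * (lam - 10) / 20 := by ring
    have e2 : -(k : ℝ) * lam / 20 + (k : ℝ) * lam / 20 = 0 := by ring
    rw [e1, e2, Real.rpow_zero, mul_one] at hmul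
    exact hmul
  -- take the `Δ`-th root
  have hΔ0 : (Δ : ℝ) ≠ 0 := by positivity
  have h3 : ((2 : ℝ) ^ ((k : ℝ) * (lam - 10) / 20)) ^ ((Δ : ℝ)⁻¹) ≤ (X ^ Δ) ^ ((Δ : ℝ)⁻¹) :=
    Real.rpow_le_rpow (by positivity) h1 (by positivity)
  rw [Real.pow_rpow_inv_natCast hX0 (by omega), ← Real.rpow_mul h2.le] at h3
  have e3 : (k : ℝ) * (lam - 10) / 20 * (Δ : ℝ)⁻¹ = (k : ℝ) * (lam - 10) / (20 * Δ) := by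
    field_simp
  rwa [e3] at h3

end

end Summit.ValiantsHypothesis.ValiantsHypothesis.Theorems.DepthWindow
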